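import Literature.NumberTheory.EllipticCurves.ManinConstantQuadraticTwistStevensHoldsProofs
import Literature.NumberTheory.EllipticCurves.ManinConstantQuadraticTwistGamma0Proofs
import Literature.NumberTheory.EllipticCurves.ManinConstantQuadraticTwistAtTwoOrdinaryProofs
import Literature.NumberTheory.EllipticCurves.ManinConstantQuadraticTwistLimbProofs
import Literature.NumberTheory.EllipticCurves.ModularCurveManinSemistableLatticeFormProofs
import Literature.NumberTheory.EllipticCurves.ModularCurveManinSemistableBridgeProofs
import Literature.NumberTheory.EllipticCurves.NewformsTwistNewCoprimeProofs
import Literature.NumberTheory.EllipticCurves.CuspFormLFunctionLevelConductorProofs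
import Literature.NumberTheory.Automorphic.BCDTModularitySemistableTwistProofs
import HarnessLib

/-!
# Crux workfile — `EllipticUnitValueSevenOfGZK` (stmt-BirchSwinnertonDyer-19945), crux idea
# `cuspidal-descent-kolyvagin-nonvanishing`: TRANSPORT OF A MODULAR PARAMETRISATION DATUM ALONG A
# QUADRATIC TWIST WITH THE SAME MANIN CONSTANT (price P-α′ of critic V#22t: non-vacuity of the REV 2
# guard `¬ 7 ∣ Dt.c` in `CuspidalDescent.KolyvaginNonvanishingModSevenTypeIII`, for EVERY member)

Planner bsd-idea-20 g26 (2026-08-28). SUPPORT FILE, not a skeleton line (W-79: nothing here is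
registered with `ledger skeleton check`; the line of record `Lines/kato_perrin_riou_zp.lean` v4 is
untouched). PROVED, no `sorry`, no new definition, no named fact introduced; no summit statement and no
crux is proved by this seat. Everything is assembled from tree theorems; the printed inputs are cited
where used.

## What is proved (THEOREM M of the memo `CuspidalDescentManin-g26.md`)

Let `A/ℚ` be an elliptic curve with an `X₀(N')`-datum `D_A` (`ModularParametrizationData A N'`:
newform `f_A`, Néron pair `Λ_A`, integer `c` with `c Λ(f_A) ⊆ Λ_A`). NO optimality of `A` or of the
datum is assumed.

* `exists_datum_c_eq_of_charTwist` — the `χ`-generic core. If `χ` is a primitive quadratic character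
  mod `m`, `N' ∣ N`, `m² ∣ N`, `f_C ∈ S₂(Γ₀(N))` is the newform of a curve `C` with
  `aₙ(f_C) = χ(n) aₙ(f_A)` and `Λ_C = g(χ)⁻¹ Λ_A` (Stevens' Lemma (5.2) shape), then `C` has an
  `X₀(N)`-datum with newform `f_C`, lattice `Λ_C` and THE SAME constant `c`. Chain (Stevens (5.4)/(5.5)
  on `Γ₀`, tree `gaussSum_mul_mem_periodLattice_of_mem_charTwist`): `w ∈ Λ(f_C) ⟹ g(χ) w ∈ Λ(f_A) ⟹
  c g(χ) w ∈ Λ_A = g(χ) Λ_C ⟹ c w ∈ Λ_C`; the datum is then the tree's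
  `ModularParametrizationData.exists_of_isNewformOf` (a datum is its arithmetic content `(f, Λ, c)`).
* `exists_datum_c_eq_of_quadraticTwist_pStar` — ODD STEP, hypothesis-minimal: `q` an odd prime with
  `q ∤ N(A)` and `(N', q) = 1`, `A` globally minimal, `C` ANY globally minimal model of `A ⊗ ℚ(√q*)`.
  Then `C` has an `X₀(N' q²)`-datum with constant `c(D_A)`. Inputs: Atkin–Li newness of the twist
  (`isNewform0_charTwist_of_coprime`), `aₙ(A ⊗ χ_{q*}) = χ_q(n) aₙ(A)` for all `n`
  (`BCDT.LFunction_quadraticTwist_pStar_apply_complex_of_not_dvd`), Stevens (5.2) at odd prime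
  conductor PROVED in the tree (`stevens1989_neronLattice_quadraticTwist_oddPrime_holds`).
* `exists_datum_c_eq_of_quadraticTwist_two_of_char` / `exists_datum_c_eq_of_quadraticTwist_two` —
  DYADIC STEP in every case `η = 1` of Stevens' Lemma (5.2): `d ∈ {−1, 2, −2}`, `A` globally minimal,
  good or multiplicative at `2`, with `d = −1 ∨ A` multiplicative at `2 ∨ a₂(A)` odd, `(N', 4|d|) = 1`,
  `C` any globally minimal model of `A ⊗ ℚ(√d)`, additive at `2`. Then `C` has an
  `X₀(N' (4|d|)²)`-datum with constant `c(D_A)` (tree `neronLattice_quadraticTwist_two_of_etaOne`).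
* `exists_datum_not_dvd_c_of_quadraticTwist_pStar` / `…_two` — the `p ∤ c` forms, and
  `exists_datum_conductorLevel_c_eq_of_quadraticTwist_pStar` / `…_two` — the same datum AT LEVEL
  `N(C)` (the binder shape `ModularParametrizationData W (W.conductorNorm ℤ)` of C⁺(i)), modulo the
  modularity binder `hnf : exists_isNewformOf` only (used to identify the level `N' m²` with `N(C)`).
* `exists_datum_c_eq_mul_of_int_mul_mem_lattice` / `exists_datum_not_dvd_c_of_int_mul_mem_lattice` —
  ISOGENY STEP (base of the chain at a non-optimal member of the isogeny class): if `a Λ_W ⊆ Λ_{W'}`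
  for an integer `a ≠ 0` (⟺ an isogeny `W → W'` over `ℚ` with pull-back scalar `a`, tree
  `isIsogenous_iff_exists_int_mul_mem_lattice`), a datum of `W` gives a datum of `W'` at the same
  level with constant `c · a`; so `p ∤ c`, `p ∤ a` (e.g. `a ∣ deg`, `p ∤ deg`) give `p ∤ c'`.

## How it pays P-α′ (memo §2; the family assembly is on paper, member by member it is this file)

Type-III members of `𝒞₇` are the globally minimal models of `49a1^{(D)}`, `7 ∤ D` (F1 certificate).
Write the discriminant of `ℚ(√D)` as a product of prime discriminants `q₁* ⋯ q_k* · t`,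
`t ∈ {1, −4, 8, −8}`. Start from Cremona's row `N = 49`: `49a1` is the `X₀(49)`-optimal curve with
`c = 1` (so `D_{49a1}` has `c = 1`, level `49`). Apply the odd step `k` times (`q_i ∤ 7·(previous
level)`, every intermediate curve `49a1^{(D')}` is good at `q_i`) and, if `t ≠ 1`, the dyadic step once
(`49a1^{(D_odd)}` is good ORDINARY at `2`: `a₂ = χ_{D_odd}(2) · a₂(49a1) = ±1` is odd, `η = 1`);
for `𝒞₇` proper (`GoodOrd W 2`, so `d_K` odd) the dyadic step is not even needed.
Result: the member `W = 49a1^{(D)}` ITSELF (optimal or not) carries an `X₀(49 d_K²) = X₀(N(W))`-datum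
with `c = 1`, and the `2`-isogenous type-III member `49a2^{(D)}` (`Δ(49a2) = 7³`) one with `c = a`,
`a ∣ 2` (isogeny step at the base `49a1 → 49a2`, then the same chain), so the guarded statement C⁺(i)
is NOT vacuous at any type-III member — with no optimality claim, no direction lemma and no Cremona
range bound. (No isogeny of degree divisible by `7` is used anywhere, so the g25 "direction lemma" for
`φ : 49a1^{(D)} → 49a3^{(D)}` is off the critical path; nothing about its pull-back scalar is claimed.)

References: [Stevens1989] Lemmas (5.2), (5.4), (5.5) pp. 96–97; [AtkinLi1978] Thm. 3.1;
[Pal2012] Lemma 3.1, Prop. 2.4; [CremonaAlgorithms1997] §2.10 and Table 1 (N = 49);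
[EdixhovenManin1991] §1; [SilvermanAEC2009] Prop. VI.3.6(b), X.2 Ex. 10.16.
-/

set_option autoImplicit false
set_option linter.dupNamespace false

noncomputable section

open scoped MatrixGroups ModularForm Classical

namespace Summit.BirchSwinnertonDyer.BirchSwinnertonDyer.Cruxes.EllipticUnitValueSevenOfGZK.CuspidalDescent

open CongruenceSubgroup WeierstrassCurve
  Literature.NumberTheory.EllipticCurves Literature.NumberTheory.EllipticCurves.ModularForms
  Literature.NumberTheory.Automorphic

/-! ## §1 The `χ`-generic core: a datum of the twist with the same constant -/

/-- **Transport of a parametrisation datum along a character twist, same constant.** `D_A` any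
`X₀(N')`-datum of any `A`; `χ` primitive quadratic mod `m`, `N' ∣ N`, `m² ∣ N`; `f_C ∈ S₂(Γ₀(N))`
the newform of `C` with `aₙ(f_C) = χ(n) aₙ(f_{D_A})`; `Λ_C` a Néron-type pair of `C` with
`Λ_C = g(χ)⁻¹ Λ_A`. Then `C` has an `X₀(N)`-datum `D` with `D.f = f_C`, `D.L = Λ_C`, `D.c = D_A.c`.
[cite: Stevens1989, Lemma (5.4) p. 97 and (5.5)] [cite: CremonaAlgorithms1997, §2.10]
[cite: SilvermanAEC2009, Prop. VI.3.6(b)] -/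
theorem exists_datum_c_eq_of_charTwist
    {A : WeierstrassCurve ℚ} [A.IsElliptic] {N' : ℕ} [NeZero N'] (DA : ModularParametrizationData A N')
    {C : WeierstrassCurve ℚ} [C.IsElliptic] {N : ℕ} [NeZero N]
    {m : ℕ} [NeZero m] {χ : DirichletCharacter ℂ m} (hχ : χ.IsQuadratic) (hprim : χ.IsPrimitive)
    (hN : N' ∣ N) (hm : m ^ 2 ∣ N)
    {fC : CuspForm (Gamma0 N) 2} (hfC : IsNewformOf C fC)
    (hf : ∀ n : ℕ, cuspCoeff fC n = χ n * cuspCoeff DA.f n)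
    {LC : PeriodPair} (hLC : IsNeronLatticeOf (C.baseChange ℂ) LC)
    (hmem : ∀ z : ℂ, z ∈ LC.lattice ↔ gaussSum χ (ZMod.stdAddChar (N := m)) * z ∈ DA.L.lattice) :
    ∃ D : ModularParametrizationData C N, D.f = fC ∧ D.L = LC ∧ D.c = DA.c := by
  have hfeq : fC = charTwist N hN hm hχ DA.f :=
    eq_of_forall_cuspCoeff_eq_gamma0 fun n ↦ by rw [hf, cuspCoeff_charTwist N hN hm hχ hprim]
  have hc : DA.c ≠ 0 := DA.maninConstant_ne_zero_holds
  -- `c Λ(f_C) ⊆ Λ_C`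
  have hle : ∀ w ∈ periodLattice fC, (DA.c : ℂ) * w ∈ LC.lattice := by
    intro w hw
    rw [hfeq] at hw
    have hw' : gaussSum χ (ZMod.stdAddChar (N := m)) * w ∈ periodLattice DA.f :=
      gaussSum_mul_mem_periodLattice_of_mem_charTwist N hN hm hχ hprim DA.f hw
    have h3 : (DA.c : ℂ) * (gaussSum χ (ZMod.stdAddChar (N := m)) * w) ∈ DA.L.lattice :=
      DA.smul_periodLattice_le _ hw'
    rw [hmem, mul_left_comm]
    exact h3
  exact ModularParametrizationData.exists_of_isNewformOf hfC hLC hc hle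

/-! ## §2 The odd step: `C ≅ A ⊗ ℚ(√q*)`, `q` odd, `q ∤ N(A)` -/

/-- **Odd step.** `q` an odd prime, `A` globally minimal with an `X₀(N')`-datum `D_A`, `q ∤ N(A)`,
`(N', q) = 1`, `C` any globally minimal model of `A.quadraticTwist q*`, `N = N' q²`. Then `C` has an
`X₀(N)`-datum with constant `D_A.c`. (Its newform is `f_{D_A} ⊗ χ_q`, new at level `N' q²` by
Atkin–Li; `aₙ(C) = χ_q(n) aₙ(A)` for all `n`; `Λ_C = g(χ_q)⁻¹ Λ_A` by Stevens (5.2), `η = 1`.)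
[cite: Stevens1989, Lemmas (5.2), (5.4) pp. 96–97] [cite: AtkinLi1978, Thm. 3.1]
[cite: SilvermanAEC2009, X.2 Exercise 10.16] -/
theorem exists_datum_c_eq_of_quadraticTwist_pStar
    {q : ℕ} [Fact q.Prime] (hq2 : q ≠ 2)
    {A : WeierstrassCurve ℚ} [A.IsElliptic] [A.IsGloballyMinimal] {N' : ℕ} [NeZero N']
    (DA : ModularParametrizationData A N')
    (hqA : ¬ q ∣ A.conductorNorm ℤ) (hcop : N'.Coprime q)
    {C : WeierstrassCurve ℚ} [C.IsElliptic] [C.IsGloballyMinimal]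
    (hCtw : ∃ v : VariableChange ℚ, v • A.quadraticTwist (((-1 : ℤ) ^ (q / 2) * q : ℤ) : ℚ) = C)
    {N : ℕ} [NeZero N] (hNdef : N = N' * q ^ 2) :
    ∃ D : ModularParametrizationData C N, D.c = DA.c := by
  subst hNdef
  have hq : q.Prime := Fact.out
  haveI : NeZero q := ⟨hq.ne_zero⟩
  set d : ℤ := (-1 : ℤ) ^ (q / 2) * q with hd
  have hdZ : d ≠ 0 := mul_ne_zero (pow_ne_zero _ (by norm_num)) (by exact_mod_cast hq.ne_zero)
  have hd0 : (d : ℚ) ≠ 0 := by exact_mod_cast hdZ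
  haveI : (A.quadraticTwist (d : ℚ)).IsElliptic := A.isElliptic_quadraticTwist hd0
  set χ : DirichletCharacter ℂ q := (quadraticChar (ZMod q)).ringHomComp (Int.castRingHom ℂ)
    with hχdef
  have hχ : χ.IsQuadratic := isQuadratic_quadraticChar_ringHomComp q
  have hprim : χ.IsPrimitive := isPrimitive_quadraticChar_ringHomComp q hq2
  have hG : gaussSum χ (ZMod.stdAddChar (N := q)) ^ 2 = ((d : ℤ) : ℂ) := by
    rw [hχdef, hd]; exact gaussSum_quadraticChar_ringHomComp_sq q hq2
  -- the coefficient identity `aₙ(C) = χ(n) aₙ(A)` for all `n`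
  have hcoef : ∀ n : ℕ, ((C.LFunction n : ℤ) : ℂ) = χ n * ((A.LFunction n : ℤ) : ℂ) := by
    intro n
    obtain ⟨v, hv⟩ := hCtw
    have hLC : C.LFunction = (A.quadraticTwist (d : ℚ)).LFunction := by rw [← hv, LFunction_smul]
    rw [hLC, hχdef, hd]
    exact BCDT.LFunction_quadraticTwist_pStar_apply_complex_of_not_dvd A hq2 hqA n
  -- the newform of `C`: the twist of `f_{D_A}`, new at level `N' q²` (Atkin–Li)
  set fC : CuspForm (Gamma0 (N' * q ^ 2)) 2 :=
    charTwist (N' * q ^ 2) (dvd_mul_right N' (q ^ 2)) (dvd_mul_left (q ^ 2) N') hχ DA.f with hfCdef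
  have hnew : IsNewform0 fC := isNewform0_charTwist_of_coprime hχ hprim hcop DA.isNewformOf.1
  have hf : ∀ n : ℕ, cuspCoeff fC n = χ n * cuspCoeff DA.f n := fun n ↦
    cuspCoeff_charTwist (N' * q ^ 2) _ _ hχ hprim DA.f n
  have hfC : IsNewformOf C fC :=
    ⟨hnew, fun n ↦ by rw [hf n, DA.isNewformOf.2 n, hcoef n]⟩
  -- a Néron pair of `C`, and Stevens (5.2): `Λ_C = g(χ)⁻¹ Λ_A`
  haveI : (C.baseChange ℂ).IsElliptic := by rw [WeierstrassCurve.baseChange]; infer_instance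
  obtain ⟨LC, hLC⟩ := exists_isNeronLatticeOf_holds (C.baseChange ℂ)
  have hsemi : A.HasGoodReductionAtPrime q ∨ A.HasMultiplicativeReductionAtPrime q :=
    hasGoodReductionAtPrime_or_hasMultiplicativeReductionAtPrime_of_not_sq_dvd_conductorNorm
      fun h ↦ hqA ((dvd_pow_self q two_ne_zero).trans h)
  have hmem : ∀ z : ℂ, z ∈ LC.lattice ↔ gaussSum χ (ZMod.stdAddChar (N := q)) * z ∈ DA.L.lattice :=
    stevens1989_neronLattice_quadraticTwist_oddPrime_holds A DA.L DA.isNeronLattice q hq2 hsemi C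
      hCtw LC hLC _ hG
  obtain ⟨D, -, -, hc⟩ := exists_datum_c_eq_of_charTwist DA hχ hprim (dvd_mul_right N' (q ^ 2))
    (dvd_mul_left (q ^ 2) N') hfC hf hLC hmem
  exact ⟨D, hc⟩

/-- **Odd step, `p ∤ c` form.** In the situation of `exists_datum_c_eq_of_quadraticTwist_pStar`,
if `p ∤ c(D_A)` then `C` has an `X₀(N' q²)`-datum `D` with `p ∤ D.c`.
[cite: Stevens1989, Lemmas (5.2), (5.4)] -/
theorem exists_datum_not_dvd_c_of_quadraticTwist_pStar
    {q : ℕ} [Fact q.Prime] (hq2 : q ≠ 2)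
    {A : WeierstrassCurve ℚ} [A.IsElliptic] [A.IsGloballyMinimal] {N' : ℕ} [NeZero N']
    (DA : ModularParametrizationData A N')
    (hqA : ¬ q ∣ A.conductorNorm ℤ) (hcop : N'.Coprime q)
    {C : WeierstrassCurve ℚ} [C.IsElliptic] [C.IsGloballyMinimal]
    (hCtw : ∃ v : VariableChange ℚ, v • A.quadraticTwist (((-1 : ℤ) ^ (q / 2) * q : ℤ) : ℚ) = C)
    {N : ℕ} [NeZero N] (hNdef : N = N' * q ^ 2) {p : ℤ} (hp : ¬ p ∣ DA.c) :
    ∃ D : ModularParametrizationData C N, ¬ p ∣ D.c := by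
  obtain ⟨D, hD⟩ := exists_datum_c_eq_of_quadraticTwist_pStar hq2 DA hqA hcop hCtw hNdef
  exact ⟨D, by rw [hD]; exact hp⟩

/-- **Odd step at the conductor level** (the binder shape of C⁺(i),
`ModularParametrizationData C (C.conductorNorm ℤ)`), modulo the modularity binder `hnf` only
(used through `IsNewformOf.level_eq_conductorNorm_of_exists_isNewformOf` to identify `N' q²` with
`N(C)`). [cite: Stevens1989, Lemmas (5.2), (5.4)] [cite: DiamondShurman2005, Thm. 8.8.1] -/
theorem exists_datum_conductorLevel_c_eq_of_quadraticTwist_pStar (hnf : exists_isNewformOf)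
    {q : ℕ} [Fact q.Prime] (hq2 : q ≠ 2)
    {A : WeierstrassCurve ℚ} [A.IsElliptic] [A.IsGloballyMinimal] {N' : ℕ} [NeZero N']
    (DA : ModularParametrizationData A N')
    (hqA : ¬ q ∣ A.conductorNorm ℤ) (hcop : N'.Coprime q)
    {C : WeierstrassCurve ℚ} [C.IsElliptic] [C.IsGloballyMinimal] [NeZero (C.conductorNorm ℤ)]
    (hCtw : ∃ v : VariableChange ℚ, v • A.quadraticTwist (((-1 : ℤ) ^ (q / 2) * q : ℤ) : ℚ) = C) :
    (∃ D : ModularParametrizationData C (C.conductorNorm ℤ), D.c = DA.c) ∧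
      C.conductorNorm ℤ = N' * q ^ 2 := by
  have hq : q.Prime := Fact.out
  haveI : NeZero q := ⟨hq.ne_zero⟩
  haveI : NeZero (N' * q ^ 2) := ⟨mul_ne_zero (NeZero.ne N') (pow_ne_zero _ hq.ne_zero)⟩
  obtain ⟨D₁, -⟩ := exists_datum_c_eq_of_quadraticTwist_pStar hq2 DA hqA hcop hCtw
    (N := N' * q ^ 2) rfl
  have hlev : N' * q ^ 2 = C.conductorNorm ℤ :=
    IsNewformOf.level_eq_conductorNorm_of_exists_isNewformOf hnf D₁.isNewformOf
  exact ⟨exists_datum_c_eq_of_quadraticTwist_pStar hq2 DA hqA hcop hCtw hlev.symm, hlev.symm⟩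

/-! ## §3 The dyadic step: `C ≅ A ⊗ ℚ(√d)`, `d ∈ {−1, 2, −2}`, every case `η = 1` -/

/-- **Dyadic step, `χ`-generic core.** `D_A` an `X₀(N')`-datum of the globally minimal `A`, good or
multiplicative at `2`, `d ∈ {−1, 2, −2}` with `d = −1 ∨ A` multiplicative at `2 ∨ a₂(A)` odd
(every case `η = 1`); `χ` primitive quadratic mod `m` with `g(χ)² = 4d`, the odd-`n` twisting
identity for `A` and `χ(n) = 0` for even `n`; `(N', m) = 1`; `C` any globally minimal model of
`A.quadraticTwist d`, additive at `2`; `N = N' m²`. Then `C` has an `X₀(N)`-datum with constant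
`D_A.c`. [cite: Stevens1989, Lemmas (5.2), (5.4) pp. 96–97] [cite: AtkinLi1978, Thm. 3.1]
[cite: Pal2012, Prop. 2.4 (Connell), case p = 2] -/
theorem exists_datum_c_eq_of_quadraticTwist_two_of_char
    {A : WeierstrassCurve ℚ} [A.IsElliptic] [A.IsGloballyMinimal] {N' : ℕ} [NeZero N']
    (DA : ModularParametrizationData A N')
    {d : ℤ} (hd : d = -1 ∨ d = 2 ∨ d = -2)
    {m : ℕ} [NeZero m] {χ : DirichletCharacter ℂ m} (hχ : χ.IsQuadratic) (hprim : χ.IsPrimitive)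
    (hG : gaussSum χ (ZMod.stdAddChar (N := m)) ^ 2 = ((4 * d : ℤ) : ℂ))
    (hχodd : ∀ n : ℕ, ¬ 2 ∣ n →
      (((A.quadraticTwist (d : ℚ)).LFunction n : ℤ) : ℂ) = χ n * ((A.LFunction n : ℤ) : ℂ))
    (hχeven : ∀ n : ℕ, 2 ∣ n → χ n = 0)
    (hsemi : A.HasGoodReductionAtPrime 2 ∨ A.HasMultiplicativeReductionAtPrime 2)
    (hη : d = -1 ∨ A.HasMultiplicativeReductionAtPrime 2 ∨ Odd (A.LFunction 2))
    (hcop : N'.Coprime m)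
    {C : WeierstrassCurve ℚ} [C.IsElliptic] [C.IsGloballyMinimal]
    (hCtw : ∃ u : VariableChange ℚ, u • A.quadraticTwist (d : ℚ) = C)
    (hadd : ¬ C.HasGoodReductionAtPrime 2 ∧ ¬ C.HasMultiplicativeReductionAtPrime 2)
    {N : ℕ} [NeZero N] (hNdef : N = N' * m ^ 2) :
    ∃ D : ModularParametrizationData C N, D.c = DA.c := by
  subst hNdef
  have hdZ : d ≠ 0 := by rcases hd with rfl | rfl | rfl <;> norm_num
  have hd0 : (d : ℚ) ≠ 0 := by exact_mod_cast hdZ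
  haveI : (A.quadraticTwist (d : ℚ)).IsElliptic := A.isElliptic_quadraticTwist hd0
  -- the coefficient identity `aₙ(C) = χ(n) aₙ(A)` for all `n`
  have hcoef : ∀ n : ℕ, ((C.LFunction n : ℤ) : ℂ) = χ n * ((A.LFunction n : ℤ) : ℂ) := by
    intro n
    by_cases h2n : 2 ∣ n
    · rw [C.LFunction_apply_eq_zero_of_not_good_of_not_mult 2 hadd.1 hadd.2 h2n, hχeven n h2n]
      simp
    · obtain ⟨u, hu⟩ := hCtw
      have hLC : C.LFunction = (A.quadraticTwist (d : ℚ)).LFunction := by rw [← hu, LFunction_smul]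
      rw [hLC]
      exact hχodd n h2n
  -- the newform of `C`: the twist of `f_{D_A}`, new at level `N' m²` (Atkin–Li)
  set fC : CuspForm (Gamma0 (N' * m ^ 2)) 2 :=
    charTwist (N' * m ^ 2) (dvd_mul_right N' (m ^ 2)) (dvd_mul_left (m ^ 2) N') hχ DA.f with hfCdef
  have hnew : IsNewform0 fC := isNewform0_charTwist_of_coprime hχ hprim hcop DA.isNewformOf.1
  have hf : ∀ n : ℕ, cuspCoeff fC n = χ n * cuspCoeff DA.f n := fun n ↦
    cuspCoeff_charTwist (N' * m ^ 2) _ _ hχ hprim DA.f n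
  have hfC : IsNewformOf C fC :=
    ⟨hnew, fun n ↦ by rw [hf n, DA.isNewformOf.2 n, hcoef n]⟩
  -- a Néron pair of `C`, and Stevens (5.2) at `2`, `η = 1`: `Λ_C = g(χ)⁻¹ Λ_A`
  haveI : (C.baseChange ℂ).IsElliptic := by rw [WeierstrassCurve.baseChange]; infer_instance
  obtain ⟨LC, hLC⟩ := exists_isNeronLatticeOf_holds (C.baseChange ℂ)
  have hmem : ∀ z : ℂ, z ∈ LC.lattice ↔ gaussSum χ (ZMod.stdAddChar (N := m)) * z ∈ DA.L.lattice :=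
    fun z ↦ neronLattice_quadraticTwist_two_of_etaOne DA.isNeronLattice hd hsemi hη C hCtw hLC hG z
  obtain ⟨D, -, -, hc⟩ := exists_datum_c_eq_of_charTwist DA hχ hprim (dvd_mul_right N' (m ^ 2))
    (dvd_mul_left (m ^ 2) N') hfC hf hLC hmem
  exact ⟨D, hc⟩

/-- **Dyadic step** for `d ∈ {−1, 2, −2}` with the characters `χ₋₄`, `χ₈`, `χ₋₈` supplied
(`m = 4|d|`, `g(χ)² = 4d`; odd-`n` twisting identities of the tree, no hypothesis at `2` for them).
`D_A` an `X₀(N')`-datum of the globally minimal `A`, semistable at `2`, with `d = −1 ∨ A`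
multiplicative at `2 ∨ a₂(A)` odd; `(N', 4|d|) = 1`; `C` any globally minimal model of `A ⊗ ℚ(√d)`,
additive at `2`; `N = N' (4|d|)²`. Then `C` has an `X₀(N)`-datum with constant `D_A.c`.
[cite: Stevens1989, Lemmas (5.2), (5.4) pp. 96–97] [cite: AtkinLi1978, Thm. 3.1]
[cite: MontgomeryVaughan2007, Thm. 9.17] -/
theorem exists_datum_c_eq_of_quadraticTwist_two
    {A : WeierstrassCurve ℚ} [A.IsElliptic] [A.IsGloballyMinimal] {N' : ℕ} [NeZero N']
    (DA : ModularParametrizationData A N')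
    {d : ℤ} (hd : d = -1 ∨ d = 2 ∨ d = -2)
    (hsemi : A.HasGoodReductionAtPrime 2 ∨ A.HasMultiplicativeReductionAtPrime 2)
    (hη : d = -1 ∨ A.HasMultiplicativeReductionAtPrime 2 ∨ Odd (A.LFunction 2))
    (hcop : N'.Coprime (4 * d.natAbs))
    {C : WeierstrassCurve ℚ} [C.IsElliptic] [C.IsGloballyMinimal]
    (hCtw : ∃ u : VariableChange ℚ, u • A.quadraticTwist (d : ℚ) = C)
    (hadd : ¬ C.HasGoodReductionAtPrime 2 ∧ ¬ C.HasMultiplicativeReductionAtPrime 2)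
    {N : ℕ} [NeZero N] (hNdef : N = N' * (4 * d.natAbs) ^ 2) :
    ∃ D : ModularParametrizationData C N, D.c = DA.c := by
  rcases hd with rfl | rfl | rfl
  · -- `χ₋₄`
    refine exists_datum_c_eq_of_quadraticTwist_two_of_char DA (Or.inl rfl)
      isQuadratic_χ₄_ringHomComp isPrimitive_χ₄_ringHomComp
      (by rw [gaussSum_χ₄_ringHomComp_sq]; norm_num) (fun n hn ↦ ?_) (fun n hn ↦ ?_) hsemi hη
      (by simpa using hcop) hCtw hadd (by rw [hNdef]; norm_num)
    · rw [show ((-1 : ℤ) : ℚ) = -1 by norm_num, A.LFunction_quadraticTwist_neg_one_apply_of_odd hn,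
        Int.cast_mul, χ₄_ringHomComp_apply_natCast]
    · rw [χ₄_ringHomComp_apply_natCast, ZMod.χ₄_nat_eq_if_mod_four, if_pos (Nat.mod_eq_zero_of_dvd hn)]
      simp
  · -- `χ₈`
    refine exists_datum_c_eq_of_quadraticTwist_two_of_char DA (Or.inr (Or.inl rfl))
      isQuadratic_χ₈_ringHomComp isPrimitive_χ₈_ringHomComp
      (by rw [gaussSum_χ₈_ringHomComp_sq]; norm_num) (fun n hn ↦ ?_) (fun n hn ↦ ?_) hsemi hη
      (by simpa using hcop) hCtw hadd (by rw [hNdef]; norm_num)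
    · rw [show ((2 : ℤ) : ℚ) = 2 by norm_num, A.LFunction_quadraticTwist_two_apply_of_odd hn,
        Int.cast_mul, χ₈_ringHomComp_apply_natCast]
    · rw [χ₈_ringHomComp_apply_natCast, ZMod.χ₈_nat_eq_if_mod_eight,
        if_pos (Nat.mod_eq_zero_of_dvd hn)]
      simp
  · -- `χ₋₈`
    refine exists_datum_c_eq_of_quadraticTwist_two_of_char DA (Or.inr (Or.inr rfl))
      isQuadratic_χ₈'_ringHomComp isPrimitive_χ₈'_ringHomComp
      (by rw [gaussSum_χ₈'_ringHomComp_sq]; norm_num) (fun n hn ↦ ?_) (fun n hn ↦ ?_) hsemi hη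
      (by simpa using hcop) hCtw hadd (by rw [hNdef]; norm_num)
    · rw [show ((-2 : ℤ) : ℚ) = -2 by norm_num, A.LFunction_quadraticTwist_neg_two_apply_of_odd hn,
        Int.cast_mul, χ₈'_ringHomComp_apply_natCast]
    · rw [χ₈'_ringHomComp_apply_natCast, ZMod.χ₈'_nat_eq_if_mod_eight,
        if_pos (Nat.mod_eq_zero_of_dvd hn)]
      simp

/-- **Dyadic step, `p ∤ c` form.** [cite: Stevens1989, Lemmas (5.2), (5.4)] -/
theorem exists_datum_not_dvd_c_of_quadraticTwist_two
    {A : WeierstrassCurve ℚ} [A.IsElliptic] [A.IsGloballyMinimal] {N' : ℕ} [NeZero N']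
    (DA : ModularParametrizationData A N')
    {d : ℤ} (hd : d = -1 ∨ d = 2 ∨ d = -2)
    (hsemi : A.HasGoodReductionAtPrime 2 ∨ A.HasMultiplicativeReductionAtPrime 2)
    (hη : d = -1 ∨ A.HasMultiplicativeReductionAtPrime 2 ∨ Odd (A.LFunction 2))
    (hcop : N'.Coprime (4 * d.natAbs))
    {C : WeierstrassCurve ℚ} [C.IsElliptic] [C.IsGloballyMinimal]
    (hCtw : ∃ u : VariableChange ℚ, u • A.quadraticTwist (d : ℚ) = C)
    (hadd : ¬ C.HasGoodReductionAtPrime 2 ∧ ¬ C.HasMultiplicativeReductionAtPrime 2)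
    {N : ℕ} [NeZero N] (hNdef : N = N' * (4 * d.natAbs) ^ 2) {p : ℤ} (hp : ¬ p ∣ DA.c) :
    ∃ D : ModularParametrizationData C N, ¬ p ∣ D.c := by
  obtain ⟨D, hD⟩ := exists_datum_c_eq_of_quadraticTwist_two DA hd hsemi hη hcop hCtw hadd hNdef
  exact ⟨D, by rw [hD]; exact hp⟩

/-- **Dyadic step at the conductor level** (binder shape of C⁺(i)), modulo `hnf` only.
[cite: Stevens1989, Lemmas (5.2), (5.4)] [cite: DiamondShurman2005, Thm. 8.8.1] -/
theorem exists_datum_conductorLevel_c_eq_of_quadraticTwist_two (hnf : exists_isNewformOf)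
    {A : WeierstrassCurve ℚ} [A.IsElliptic] [A.IsGloballyMinimal] {N' : ℕ} [NeZero N']
    (DA : ModularParametrizationData A N')
    {d : ℤ} (hd : d = -1 ∨ d = 2 ∨ d = -2)
    (hsemi : A.HasGoodReductionAtPrime 2 ∨ A.HasMultiplicativeReductionAtPrime 2)
    (hη : d = -1 ∨ A.HasMultiplicativeReductionAtPrime 2 ∨ Odd (A.LFunction 2))
    (hcop : N'.Coprime (4 * d.natAbs))
    {C : WeierstrassCurve ℚ} [C.IsElliptic] [C.IsGloballyMinimal] [NeZero (C.conductorNorm ℤ)]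
    (hCtw : ∃ u : VariableChange ℚ, u • A.quadraticTwist (d : ℚ) = C)
    (hadd : ¬ C.HasGoodReductionAtPrime 2 ∧ ¬ C.HasMultiplicativeReductionAtPrime 2) :
    (∃ D : ModularParametrizationData C (C.conductorNorm ℤ), D.c = DA.c) ∧
      C.conductorNorm ℤ = N' * (4 * d.natAbs) ^ 2 := by
  have hdZ : d ≠ 0 := by rcases hd with rfl | rfl | rfl <;> norm_num
  haveI : NeZero (N' * (4 * d.natAbs) ^ 2) :=
    ⟨mul_ne_zero (NeZero.ne N') (pow_ne_zero _ (mul_ne_zero (by norm_num)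
      (Int.natAbs_ne_zero.mpr hdZ)))⟩
  obtain ⟨D₁, -⟩ := exists_datum_c_eq_of_quadraticTwist_two DA hd hsemi hη hcop hCtw hadd
    (N := N' * (4 * d.natAbs) ^ 2) rfl
  have hlev : N' * (4 * d.natAbs) ^ 2 = C.conductorNorm ℤ :=
    IsNewformOf.level_eq_conductorNorm_of_exists_isNewformOf hnf D₁.isNewformOf
  exact ⟨exists_datum_c_eq_of_quadraticTwist_two DA hd hsemi hη hcop hCtw hadd hlev.symm, hlev.symm⟩

/-! ## §4 Two consecutive odd steps (the shape of the induction over the prime discriminants) -/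

/-- **Two odd steps composed** (`q₁ ≠ q₂` odd primes not dividing `N(A)`, `(N', q₁ q₂) = 1`):
from an `X₀(N')`-datum of `A` to an `X₀(N' q₁² q₂²)`-datum of any globally minimal model `C₂` of
`(A ⊗ q₁*) ⊗ q₂*` with the same constant — the induction step of the memo's chain over the prime
discriminants of `d_K`, displayed once. The hypothesis `q₂ ∤ N(C₁)` is displayed (for the family it
is `N(C₁) = N(A) q₁²`). [cite: Stevens1989, Lemmas (5.2), (5.4)] -/
theorem exists_datum_c_eq_of_quadraticTwist_pStar_pStar
    {q₁ q₂ : ℕ} [Fact q₁.Prime] [Fact q₂.Prime] (hq₁ : q₁ ≠ 2) (hq₂ : q₂ ≠ 2)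
    {A : WeierstrassCurve ℚ} [A.IsElliptic] [A.IsGloballyMinimal] {N' : ℕ} [NeZero N']
    (DA : ModularParametrizationData A N')
    (hq₁A : ¬ q₁ ∣ A.conductorNorm ℤ) (hcop₁ : N'.Coprime q₁)
    {C₁ : WeierstrassCurve ℚ} [C₁.IsElliptic] [C₁.IsGloballyMinimal]
    (hC₁ : ∃ v : VariableChange ℚ, v • A.quadraticTwist (((-1 : ℤ) ^ (q₁ / 2) * q₁ : ℤ) : ℚ) = C₁)
    (hq₂C₁ : ¬ q₂ ∣ C₁.conductorNorm ℤ) (hcop₂ : (N' * q₁ ^ 2).Coprime q₂)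
    {C₂ : WeierstrassCurve ℚ} [C₂.IsElliptic] [C₂.IsGloballyMinimal]
    (hC₂ : ∃ v : VariableChange ℚ, v • C₁.quadraticTwist (((-1 : ℤ) ^ (q₂ / 2) * q₂ : ℤ) : ℚ) = C₂)
    {N : ℕ} [NeZero N] (hNdef : N = N' * q₁ ^ 2 * q₂ ^ 2) :
    ∃ D : ModularParametrizationData C₂ N, D.c = DA.c := by
  have hq1 : q₁.Prime := Fact.out
  haveI : NeZero (N' * q₁ ^ 2) := ⟨mul_ne_zero (NeZero.ne N') (pow_ne_zero _ hq1.ne_zero)⟩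
  obtain ⟨D₁, hD₁⟩ := exists_datum_c_eq_of_quadraticTwist_pStar hq₁ DA hq₁A hcop₁ hC₁
    (N := N' * q₁ ^ 2) rfl
  obtain ⟨D₂, hD₂⟩ := exists_datum_c_eq_of_quadraticTwist_pStar hq₂ D₁ hq₂C₁ hcop₂ hC₂ hNdef
  exact ⟨D₂, hD₂.trans hD₁⟩



/-! ## §5 The isogeny step (base of the chain at a non-optimal member of the class) -/

/-- **Isogeny step.** `D_W` an `X₀(N)`-datum of `W`; `W'` elliptic with a Néron-type pair `Λ'` and
an integer `a ≠ 0` with `a Λ_W ⊆ Λ'` (equivalently an isogeny `W → W'` over `ℚ` with pull-back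
scalar `a`, tree `isIsogenous_iff_exists_int_mul_mem_lattice`). Then `W'` has an `X₀(N)`-datum
with newform `f_{D_W}` (isogenous curves share the newform), lattice `Λ'` and constant `D_W.c · a`.
[cite: SilvermanAEC2009, Thm. VI.4.1 (b), Cor. III.6.1] [cite: Knapp1993, Thm. 11.67 (PDF p. 281)]
[cite: CremonaAlgorithms1997, §2.10] -/
theorem exists_datum_c_eq_mul_of_int_mul_mem_lattice
    {W : WeierstrassCurve ℚ} [W.IsElliptic] {N : ℕ} [NeZero N] (DW : ModularParametrizationData W N)
    {W' : WeierstrassCurve ℚ} [W'.IsElliptic] {L' : PeriodPair}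
    (hL' : IsNeronLatticeOf (W'.baseChange ℂ) L') {a : ℤ} (ha : a ≠ 0)
    (hle : ∀ z ∈ DW.L.lattice, (a : ℂ) * z ∈ L'.lattice) :
    ∃ D : ModularParametrizationData W' N, D.f = DW.f ∧ D.L = L' ∧ D.c = DW.c * a := by
  have hiso : WeierstrassCurve.IsIsogenous W W' :=
    (isIsogenous_iff_exists_int_mul_mem_lattice DW.isNeronLattice hL').mpr ⟨a, ha, hle⟩
  have hf : IsNewformOf W' DW.f := DW.isNewformOf.of_isIsogenous hiso.symm_of_charZero
  have hc : DW.c * a ≠ 0 := mul_ne_zero DW.maninConstant_ne_zero_holds ha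
  refine ModularParametrizationData.exists_of_isNewformOf hf hL' hc fun z hz ↦ ?_
  rw [Int.cast_mul, mul_comm (DW.c : ℂ), mul_assoc]
  exact hle _ (DW.smul_periodLattice_le z hz)

/-- **Isogeny step, `p ∤ c` form**: `p` prime, `p ∤ c(D_W)`, `p ∤ a` (e.g. `a ∣ deg φ` with
`p ∤ deg φ`, as for the `2`-isogeny `49a1 → 49a2` and `p = 7`) give a datum of `W'` with `p ∤ c`.
[cite: SilvermanAEC2009, Thm. VI.4.1 (b), Thm. III.6.2] -/
theorem exists_datum_not_dvd_c_of_int_mul_mem_lattice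
    {W : WeierstrassCurve ℚ} [W.IsElliptic] {N : ℕ} [NeZero N] (DW : ModularParametrizationData W N)
    {W' : WeierstrassCurve ℚ} [W'.IsElliptic] {L' : PeriodPair}
    (hL' : IsNeronLatticeOf (W'.baseChange ℂ) L') {a : ℤ} (ha : a ≠ 0)
    (hle : ∀ z ∈ DW.L.lattice, (a : ℂ) * z ∈ L'.lattice)
    {p : ℤ} (hp : Prime p) (hpc : ¬ p ∣ DW.c) (hpa : ¬ p ∣ a) :
    ∃ D : ModularParametrizationData W' N, ¬ p ∣ D.c := by
  obtain ⟨D, -, -, hD⟩ := exists_datum_c_eq_mul_of_int_mul_mem_lattice DW hL' ha hle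
  exact ⟨D, fun h ↦ (hp.dvd_mul.mp (hD ▸ h)).elim hpc hpa⟩

end Summit.BirchSwinnertonDyer.BirchSwinnertonDyer.Cruxes.EllipticUnitValueSevenOfGZK.CuspidalDescent

end
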